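import Literature.Probability.Percolation.QuadCrossingSpace
import Mathlib.Topology.ContinuousMap.SecondCountableSpace
import Mathlib.Topology.Metrizable.Urysohn
import Mathlib.MeasureTheory.Constructions.BorelSpace.Basic
import HarnessLib

/-!
# The space of closed lower sets of quads: Schramm–Smirnov's abstract §3

Topic `Literature/Probability/Percolation`; first proofs file towards the named fact
`SchrammSmirnov2011_thm_1_4` of `QuadCrossingSpace.lean` (O. Schramm, S. Smirnov, *On the scaling
limits of planar percolation*, Ann. Probab. 39 (2011), arXiv:1101.5820, Thm. 1.4).

The printed proof (§3, "The space of lower sets", Thm. 3.9 ⇒ Thm. 1.4) is an abstract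
construction for a topological space `X` with a strict partial order `<` such that
`(eopen)` the relation `{(x, y) : x < y}` is open in `X²` and `(esb)` every `x` lies in the closure
of `ℛˣ = {y : y < x}`; `ℋ_X` is the set of closed lower sets with the topology generated by
`V_U = {S : S ∩ U ≠ ∅}` (`U` open) and `V^x = {S : x ∉ S}`.  Here `X = 𝒬_D` (`Quad D`), `<` is
`Quad.StrictlyDominated` (open by definition, transitive: `Quad.StrictlyDominated.trans`), and
`ℋ_X = QuadConfig D` with `QuadConfig.instTopologicalSpace`.  This file proves, following the
source lemma by lemma:

* `QuadConfig.compactSpace` — **Prop. 3.1–3.2 / Remark 10**: `ℋ_D` is compact, by Alexander's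
  subbase theorem (`compactSpace_generateFrom`) applied directly to the subbase `V_U`, `V^Q`
  (given a subbasic cover, the closed lower set `{x ∉ Ũ : ℛˣ ∩ Ũ = ∅}`, `Ũ` the union of the
  `U`'s, lies in some `V^{x₀}`, and then `{V_{U₀}, V^{x₀}}` is a subcover).  No `(esb)` needed.
* under the hypothesis `(esb)` for `𝒬_D` (proved for quads in the sibling file
  `QuadCrossingSpaceProofs.lean`; here an explicit hypothesis `hesb`):
  `QuadConfig.t2Space_of_esb` (**Prop. 3.3**), `QuadConfig.eq_of_inter_dense_eq_of_esb`
  (**Lemma 3.4**), `QuadConfig.secondCountableTopology_of_esb` (**Lemma 3.6**: the `V_U`, `U` in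
  a countable basis, and `V^x`, `x` in a countable dense set, form a countable subbase),
  `QuadConfig.metrizableSpace_of_esb` (Urysohn: compact Hausdorff second-countable spaces are
  metrizable, `TopologicalSpace.metrizableSpace_of_t3_secondCountable`),
  `QuadConfig.generateFrom_notCrossed_eq_borel_of_esb` (**Lemma 3.7**; the printed proof writes
  `V^x = ⋃_{y ∈ X₀ ∩ ℛˣ} V^y` over a possibly uncountable dense `X₀` — we first pass to a
  countable dense `X₀' ⊆ X₀`, `Dense.exists_countable_dense_subset`, and use
  `borel_eq_generateFrom_of_subbasis`).
* `SchrammSmirnov2011_thm_1_4_of_esb`: Theorem 1.4 (1)–(2) follows from `(esb)` for quads.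

Second countability of `𝒬_D` ("clearly second-countable", p. 14 of the source): `Quad D` carries
the topology induced from `C([0,1]², ℂ)`, which is second countable
(`ContinuousMap.instSecondCountableTopology`).

## References

* O. Schramm, S. Smirnov, *On the scaling limits of planar percolation*, Ann. Probab. 39 (2011)
  1768–1814, §3 (Prop. 3.1–3.3, Remark 10, Lemmas 3.4, 3.6, 3.7, Thm. 3.9). [SchrammSmirnov2011]
-/

noncomputable section

open scoped unitInterval
open Set Filter TopologicalSpace
open _root_.MeasureTheory _root_.Topology

namespace Literature.Probability.Percolation

namespace QuadCrossing

variable {D : Set ℂ}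

/-! ### The order `<` on quads: transitivity, open sections, second countability of `𝒬_D` -/

namespace Quad

/-- `<` is transitive (from transitivity of `≤` and the definition of `<` as the interior of
`≤`). [cite: SchrammSmirnov2011, §1.3] -/
theorem StrictlyDominated.trans {Q₁ Q₂ Q₃ : Quad D} (h₁ : StrictlyDominated Q₁ Q₂)
    (h₂ : StrictlyDominated Q₂ Q₃) : StrictlyDominated Q₁ Q₃ := by
  obtain ⟨U₁, U₂, hU₁, -, h₁m, h₂m, h⟩ := strictlyDominated_iff.mp h₁
  obtain ⟨U₂', U₃, -, hU₃, h₂m', h₃m, h'⟩ := strictlyDominated_iff.mp h₂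
  exact strictlyDominated_iff.mpr ⟨U₁, U₃, hU₁, hU₃, h₁m, h₃m, fun Q hQ Q' hQ' =>
    (h Q hQ Q₂ h₂m).trans (h' Q₂ h₂m' Q' hQ')⟩

/-- The upper section `ℛ_Q = {Q' : Q < Q'}` is open (`(eopen)`). [cite: SchrammSmirnov2011, §3 (1)] -/
theorem isOpen_setOf_strictlyDominated_right (Q : Quad D) :
    IsOpen {Q' | StrictlyDominated Q Q'} :=
  isOpen_interior.preimage (Continuous.prodMk_right Q)

/-- The lower section `ℛ^Q = {Q' : Q' < Q}` is open (`(eopen)`). [cite: SchrammSmirnov2011, §3 (1)] -/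
theorem isOpen_setOf_strictlyDominated_left (Q : Quad D) :
    IsOpen {Q' | StrictlyDominated Q' Q} :=
  isOpen_interior.preimage (Continuous.prodMk_left Q)

/-- `𝒬_D` is second countable ("clearly", p. 14 of the source): its topology is induced from
the second-countable space `C([0,1]², ℂ)`. [cite: SchrammSmirnov2011, §3] -/
theorem secondCountableTopology : SecondCountableTopology (Quad D) :=
  (Topology.IsInducing.induced (toContinuousMap (D := D))).secondCountableTopology

end Quad

namespace QuadConfig

/-! ### Compactness (Prop. 3.1–3.2, Remark 10) -/

/-- **`ℋ_D` is compact** (Schramm–Smirnov, Prop. 3.1–3.2 with Remark 10), by Alexander's subbase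
theorem for the subbase `V_U` (`U` open), `V^Q`: if `{V_U}_{U ∈ I} ∪ {V^Q}_{Q ∈ J}` covers `ℋ_D`,
let `Ũ = ⋃ I`; the set `L = {x ∉ Ũ : y ∉ Ũ for all y < x}` is a closed lower set missing `Ũ`,
so `L ∈ V^{x₀}` for some `x₀ ∈ J`, i.e. `x₀ ∈ U₀` or some `y < x₀` lies in `U₀`, `U₀ ∈ I`; in
both cases `{V_{U₀}, V^{x₀}}` covers (a lower set containing `x₀` contains `y`).
[cite: SchrammSmirnov2011, §3 Prop. 3.1–3.2 and Remark 10] -/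
theorem compactSpace : CompactSpace (QuadConfig D) := by
  refine compactSpace_generateFrom (X := QuadConfig D) rfl fun P hPS hP => ?_
  classical
  -- the union `Ũ` of the open sets `U` with `V_U ∈ P`
  set Ut : Set (Quad D) := {q | ∃ U : Set (Quad D), IsOpen U ∧ someCrossed U ∈ P ∧ q ∈ U}
    with hUt
  have hUt_open : IsOpen Ut := by
    have : Ut = ⋃ U ∈ {U : Set (Quad D) | IsOpen U ∧ someCrossed U ∈ P}, U := by
      ext q; simp [hUt, and_assoc]
    rw [this]
    exact isOpen_biUnion fun U hU => hU.1
  -- the closed lower set `L`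
  set L₀ : Set (Quad D) := {x | x ∉ Ut ∧ ∀ y, Quad.StrictlyDominated y x → y ∉ Ut} with hL₀
  have hL₀c : IsClosed L₀ := by
    have : L₀ᶜ = Ut ∪ ⋃ y ∈ Ut, {x | Quad.StrictlyDominated y x} := by
      ext x
      simp only [hL₀, mem_compl_iff, mem_setOf_eq, not_and, not_forall, not_not, mem_union,
        mem_iUnion, exists_prop]
      by_cases hx : x ∈ Ut
      · simp [hx]
      · simp only [hx, not_false_eq_true, forall_const, false_or]
        constructor
        · rintro ⟨y, hy, hyU⟩; exact ⟨y, hyU, hy⟩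
        · rintro ⟨y, hyU, hy⟩; exact ⟨y, hy, hyU⟩
    rw [← isOpen_compl_iff, this]
    exact hUt_open.union (isOpen_biUnion fun y _ => Quad.isOpen_setOf_strictlyDominated_right y)
  have hL₀l : IsLowerQuadSet L₀ := by
    intro x hx y hyx
    exact ⟨hx.2 y hyx, fun z hzy => hx.2 z (hzy.trans hyx)⟩
  let L : QuadConfig D := ⟨L₀, hL₀c, hL₀l⟩
  have hLmem : L ∈ ⋃₀ P := by rw [hP]; exact mem_univ _
  obtain ⟨V, hVP, hLV⟩ := hLmem
  -- a two-element subcover `{V_{U₀}, V^{x₀}}`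
  have cover : ∀ (U₀ : Set (Quad D)) (x₀ : Quad D), someCrossed U₀ ∈ P → notCrossed x₀ ∈ P →
      (∀ S : QuadConfig D, x₀ ∈ S → ((S : Set (Quad D)) ∩ U₀).Nonempty) →
      ∃ Q ⊆ P, Q.Finite ∧ ⋃₀ Q = univ := by
    intro U₀ x₀ hU₀ hx₀ h
    refine ⟨{someCrossed U₀, notCrossed x₀}, ?_, ?_, ?_⟩
    · intro W hW
      rcases hW with rfl | rfl
      · exact hU₀
      · exact hx₀
    · exact (finite_singleton _).insert _
    · refine eq_univ_of_forall fun S => ?_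
      by_cases hS : x₀ ∈ S
      · exact ⟨someCrossed U₀, Or.inl rfl, h S hS⟩
      · exact ⟨notCrossed x₀, Or.inr rfl, hS⟩
  rcases hPS hVP with ⟨U, hU, rfl⟩ | ⟨x₀, rfl⟩
  · -- `L ∈ V_U` is impossible: `L` misses `Ũ ⊇ U`
    obtain ⟨q, hqL, hqU⟩ := hLV
    exact (hqL.1 ⟨U, hU, hVP, hqU⟩).elim
  · -- `L ∈ V^{x₀}`, i.e. `x₀ ∉ L`
    have hx₀ : x₀ ∉ L₀ := hLV
    simp only [hL₀, mem_setOf_eq, not_and, not_forall, not_not] at hx₀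
    by_cases hx₀U : x₀ ∈ Ut
    · obtain ⟨U₀, hU₀, hU₀P, hxU₀⟩ := hx₀U
      exact cover U₀ x₀ hU₀P hVP fun S hS => ⟨x₀, hS, hxU₀⟩
    · obtain ⟨y, hyx, hyU⟩ := hx₀ hx₀U
      obtain ⟨U₀, hU₀, hU₀P, hyU₀⟩ := hyU
      exact cover U₀ x₀ hU₀P hVP fun S hS => ⟨y, S.isLowerQuadSet hS hyx, hyU₀⟩

/-! ### Consequences of `(esb)` -/

section Esb

/-- Under `(esb)`: if `x ∉ S` (`S ∈ ℋ_D`) and `U ∋ x` is open, some `y < x` in `U` is not in `S`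
("by `(esb)` the open set `ℛˣ ∖ S` is nonempty"). [cite: SchrammSmirnov2011, §3 (proof of Prop. 3.3)] -/
theorem exists_strictlyDominated_notMem_of_esb
    (hesb : ∀ Q : Quad D, Q ∈ closure {Q' | Quad.StrictlyDominated Q' Q})
    {S : QuadConfig D} {x : Quad D} (hx : x ∉ S) {U : Set (Quad D)} (hU : IsOpen U)
    (hxU : x ∈ U) : ∃ y ∈ U, Quad.StrictlyDominated y x ∧ y ∉ S := by
  have hO : IsOpen (U ∩ (S : Set (Quad D))ᶜ) := hU.inter S.isClosed.isOpen_compl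
  obtain ⟨y, ⟨hyU, hyS⟩, hyx⟩ := mem_closure_iff.mp (hesb x) _ hO ⟨hxU, hx⟩
  exact ⟨y, hyU, hyx, hyS⟩

/-- Under `(esb)`, with `A` dense: if `x ∉ S` and `U ∋ x` is open, some `y ∈ A ∩ U` with `y < x`
is not in `S` (the open set `U ∩ ℛˣ ∖ S` is nonempty, so it meets `A`).
[cite: SchrammSmirnov2011, §3 (proof of Lemma 3.4)] -/
theorem exists_mem_dense_strictlyDominated_notMem_of_esb
    (hesb : ∀ Q : Quad D, Q ∈ closure {Q' | Quad.StrictlyDominated Q' Q})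
    {A : Set (Quad D)} (hA : Dense A) {S : QuadConfig D} {x : Quad D} (hx : x ∉ S)
    {U : Set (Quad D)} (hU : IsOpen U) (hxU : x ∈ U) :
    ∃ y ∈ A, y ∈ U ∧ Quad.StrictlyDominated y x ∧ y ∉ S := by
  have hO : IsOpen (U ∩ (S : Set (Quad D))ᶜ ∩ {Q' | Quad.StrictlyDominated Q' x}) :=
    (hU.inter S.isClosed.isOpen_compl).inter (Quad.isOpen_setOf_strictlyDominated_left x)
  obtain ⟨y₀, hy₀U, hy₀x, hy₀S⟩ := exists_strictlyDominated_notMem_of_esb hesb hx hU hxU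
  obtain ⟨y, hyO, hyA⟩ := hA.inter_open_nonempty _ hO ⟨y₀, ⟨hy₀U, hy₀S⟩, hy₀x⟩
  exact ⟨y, hyA, hyO.1.1, hyO.2, hyO.1.2⟩

/-- **`ℋ_D` is Hausdorff** under `(esb)` (Schramm–Smirnov, Prop. 3.3): for `H₁ ≠ H₂` take
`x ∈ H₁ ∖ H₂` and `y < x` with `y ∉ H₂`; then `V_{ℛ_y} ∋ H₁` and `V^y ∋ H₂` are disjoint open
sets. [cite: SchrammSmirnov2011, §3 Prop. 3.3] -/
theorem t2Space_of_esb (hesb : ∀ Q : Quad D, Q ∈ closure {Q' | Quad.StrictlyDominated Q' Q}) :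
    T2Space (QuadConfig D) := by
  -- the one-sided separation
  have key : ∀ H₁ H₂ : QuadConfig D, ∀ x : Quad D, x ∈ H₁ → x ∉ H₂ →
      ∃ u v : Set (QuadConfig D), IsOpen u ∧ IsOpen v ∧ H₁ ∈ u ∧ H₂ ∈ v ∧ Disjoint u v := by
    intro H₁ H₂ x hx₁ hx₂
    obtain ⟨y, -, hyx, hy₂⟩ :=
      exists_strictlyDominated_notMem_of_esb hesb hx₂ isOpen_univ (mem_univ x)
    refine ⟨someCrossed {z | Quad.StrictlyDominated y z}, notCrossed y,
      isOpen_someCrossed (Quad.isOpen_setOf_strictlyDominated_right y), isOpen_notCrossed y,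
      ⟨x, hx₁, hyx⟩, hy₂, ?_⟩
    rw [Set.disjoint_left]
    rintro S ⟨z, hzS, hyz⟩ hyS
    exact hyS (S.isLowerQuadSet hzS hyz)
  refine ⟨fun H₁ H₂ hne => ?_⟩
  rw [Ne, QuadConfig.ext_iff, not_forall] at hne
  obtain ⟨x, hx⟩ := hne
  rw [not_iff] at hx
  by_cases hx₂ : x ∈ H₂
  · have hx₁ : x ∉ H₁ := hx.mpr hx₂
    obtain ⟨u, v, hu, hv, h₂u, h₁v, huv⟩ := key H₂ H₁ x hx₂ hx₁
    exact ⟨v, u, hv, hu, h₁v, h₂u, huv.symm⟩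
  · have hx₁ : x ∈ H₁ := not_not.mp (mt hx.mp hx₂)
    exact key H₁ H₂ x hx₁ hx₂

/-- **A dense set of quads determines the configuration** under `(esb)` (Schramm–Smirnov,
Lemma 3.4): if `A ⊆ 𝒬_D` is dense and `S₁ ∩ A = S₂ ∩ A` then `S₁ = S₂`.
[cite: SchrammSmirnov2011, §3 Lemma 3.4] -/
theorem eq_of_inter_dense_eq_of_esb
    (hesb : ∀ Q : Quad D, Q ∈ closure {Q' | Quad.StrictlyDominated Q' Q})
    {A : Set (Quad D)} (hA : Dense A) {S₁ S₂ : QuadConfig D}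
    (h : (S₁ : Set (Quad D)) ∩ A = (S₂ : Set (Quad D)) ∩ A) : S₁ = S₂ := by
  -- the one-sided statement
  have key : ∀ T₁ T₂ : QuadConfig D, (T₁ : Set (Quad D)) ∩ A = (T₂ : Set (Quad D)) ∩ A →
      ∀ x, x ∈ T₁ → x ∈ T₂ := by
    intro T₁ T₂ hT x hx₁
    by_contra hx₂
    obtain ⟨y, hyA, -, hyx, hy₂⟩ :=
      exists_mem_dense_strictlyDominated_notMem_of_esb hesb hA hx₂ isOpen_univ (mem_univ x)
    have hy₁ : y ∈ (T₁ : Set (Quad D)) ∩ A := ⟨T₁.isLowerQuadSet hx₁ hyx, hyA⟩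
    rw [hT] at hy₁
    exact hy₂ hy₁.1
  exact QuadConfig.ext fun x => ⟨key S₁ S₂ h x, key S₂ S₁ h.symm x⟩

/-- Under `(esb)`: `V^x = ⋃ {V^y : y ∈ A, y < x}` for any dense `A` (eq. (3.3) of the source,
there for a countable dense `X₀`). [cite: SchrammSmirnov2011, §3 (3.3)] -/
theorem notCrossed_eq_biUnion_of_esb
    (hesb : ∀ Q : Quad D, Q ∈ closure {Q' | Quad.StrictlyDominated Q' Q})
    {A : Set (Quad D)} (hA : Dense A) (x : Quad D) :
    notCrossed x = ⋃ y ∈ {y ∈ A | Quad.StrictlyDominated y x}, notCrossed y := by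
  ext S
  simp only [mem_iUnion, exists_prop, mem_setOf_eq]
  constructor
  · intro hx
    obtain ⟨y, hyA, -, hyx, hyS⟩ :=
      exists_mem_dense_strictlyDominated_notMem_of_esb hesb hA hx isOpen_univ (mem_univ x)
    exact ⟨y, ⟨hyA, hyx⟩, hyS⟩
  · rintro ⟨y, ⟨-, hyx⟩, hyS⟩ hxS
    exact hyS (S.isLowerQuadSet hxS hyx)

/-- Under `(esb)`: `V_U = ⋃ {¬V^y : y ∈ A ∩ U}` for `U` open and `A` dense (proof of Lemma 3.7:
for `x ∈ U ∩ S` pick `y ∈ A ∩ U ∩ ℛˣ`, then `y ∈ S`). [cite: SchrammSmirnov2011, §3 (proof of Lemma 3.7)] -/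
theorem someCrossed_eq_biUnion_of_esb
    (hesb : ∀ Q : Quad D, Q ∈ closure {Q' | Quad.StrictlyDominated Q' Q})
    {A : Set (Quad D)} (hA : Dense A) {U : Set (Quad D)} (hU : IsOpen U) :
    someCrossed U = ⋃ y ∈ A ∩ U, (notCrossed y)ᶜ := by
  ext S
  simp only [someCrossed, mem_setOf_eq, mem_iUnion, mem_compl_iff, exists_prop, mem_inter_iff]
  constructor
  · rintro ⟨x, hxS, hxU⟩
    have hO : IsOpen (U ∩ {Q' | Quad.StrictlyDominated Q' x}) :=
      hU.inter (Quad.isOpen_setOf_strictlyDominated_left x)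
    obtain ⟨y₀, hy₀U, hy₀x⟩ := mem_closure_iff.mp (hesb x) U hU hxU
    obtain ⟨y, ⟨hyU, hyx⟩, hyA⟩ := hA.inter_open_nonempty _ hO ⟨y₀, hy₀U, hy₀x⟩
    exact ⟨y, ⟨hyA, hyU⟩, not_not.mpr (S.isLowerQuadSet hxS hyx)⟩
  · rintro ⟨y, ⟨-, hyU⟩, hyS⟩
    exact ⟨y, not_not.mp hyS, hyU⟩

/-- The countable subbase of Lemma 3.6: under `(esb)`, for a topological basis `B` of `𝒬_D` and
a dense `A ⊆ 𝒬_D`, the sets `V_U` (`U ∈ B`) and `V^y` (`y ∈ A`) generate the topology `𝒯_D`.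
[cite: SchrammSmirnov2011, §3 Lemma 3.6] -/
theorem eq_generateFrom_of_esb
    (hesb : ∀ Q : Quad D, Q ∈ closure {Q' | Quad.StrictlyDominated Q' Q})
    {B : Set (Set (Quad D))} (hB : IsTopologicalBasis B) {A : Set (Quad D)} (hA : Dense A) :
    (instTopologicalSpace : TopologicalSpace (QuadConfig D)) =
      generateFrom ((fun U => someCrossed U) '' B ∪ (fun y => notCrossed y) '' A) := by
  refine le_antisymm (le_generateFrom ?_) (le_generateFrom ?_)
  · rintro V (⟨U, hU, rfl⟩ | ⟨y, -, rfl⟩)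
    · exact isOpen_someCrossed (hB.isOpen hU)
    · exact isOpen_notCrossed y
  · rintro V (⟨U, hU, rfl⟩ | ⟨x, rfl⟩)
    · -- `V_U = ⋃ {V_{U'} : U' ∈ B, U' ⊆ U}`
      obtain ⟨S, hSB, rfl⟩ := hB.open_eq_sUnion hU
      have : someCrossed (⋃₀ S) = ⋃ U' ∈ S, someCrossed U' := by
        ext T
        simp only [someCrossed, mem_setOf_eq, mem_iUnion, exists_prop]
        constructor
        · rintro ⟨q, hqT, U', hU'S, hqU'⟩; exact ⟨U', hU'S, q, hqT, hqU'⟩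
        · rintro ⟨U', hU'S, q, hqT, hqU'⟩; exact ⟨q, hqT, U', hU'S, hqU'⟩
      rw [this]
      exact @isOpen_biUnion _ _ (generateFrom _) _ _ fun U' hU' =>
        isOpen_generateFrom_of_mem (Or.inl ⟨U', hSB hU', rfl⟩)
    · rw [notCrossed_eq_biUnion_of_esb hesb hA x]
      exact @isOpen_biUnion _ _ (generateFrom _) _ _ fun y hy =>
        isOpen_generateFrom_of_mem (Or.inr ⟨y, hy.1, rfl⟩)

/-- **`ℋ_D` is second countable** under `(esb)` (Schramm–Smirnov, Lemma 3.6): `𝒬_D` has a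
countable basis and a countable dense subset, giving a countable subbase of `𝒯_D`.
[cite: SchrammSmirnov2011, §3 Lemma 3.6] -/
theorem secondCountableTopology_of_esb
    (hesb : ∀ Q : Quad D, Q ∈ closure {Q' | Quad.StrictlyDominated Q' Q}) :
    SecondCountableTopology (QuadConfig D) := by
  haveI := Quad.secondCountableTopology (D := D)
  obtain ⟨B, hBc, -, hB⟩ := exists_countable_basis (Quad D)
  obtain ⟨A, hAc, hA⟩ := exists_countable_dense (Quad D)
  exact ⟨⟨_, (hBc.image _).union (hAc.image _), eq_generateFrom_of_esb hesb hB hA⟩⟩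

/-- **`ℋ_D` is metrizable** under `(esb)` (Schramm–Smirnov, Lemma 3.6: "a second-countable
compact Hausdorff space is metrizable", Urysohn). [cite: SchrammSmirnov2011, §3 Lemma 3.6] -/
theorem metrizableSpace_of_esb
    (hesb : ∀ Q : Quad D, Q ∈ closure {Q' | Quad.StrictlyDominated Q' Q}) :
    MetrizableSpace (QuadConfig D) := by
  haveI := compactSpace (D := D)
  haveI := t2Space_of_esb hesb
  haveI := secondCountableTopology_of_esb hesb
  exact metrizableSpace_of_t3_secondCountable (QuadConfig D)

/-- **The Borel `σ`-field is generated by the `V^y`, `y ∈ A`**, for any dense `A ⊆ 𝒬_D`, under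
`(esb)` (Schramm–Smirnov, Lemma 3.7).  We pass to a countable dense `A₀ ⊆ A`; the countable
subbase `V_U` (`U` in a countable basis), `V^y` (`y ∈ A₀`) generates the Borel `σ`-field
(`borel_eq_generateFrom_of_subbasis`), and `V_U = ⋃_{y ∈ A₀ ∩ U} ¬V^y` is a countable union.
[cite: SchrammSmirnov2011, §3 Lemma 3.7] -/
theorem generateFrom_notCrossed_eq_borel_of_esb
    (hesb : ∀ Q : Quad D, Q ∈ closure {Q' | Quad.StrictlyDominated Q' Q})
    {A : Set (Quad D)} (hA : Dense A) :
    MeasurableSpace.generateFrom ((fun Q => notCrossed Q) '' A) = borel (QuadConfig D) := by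
  haveI := Quad.secondCountableTopology (D := D)
  haveI := secondCountableTopology_of_esb hesb
  refine le_antisymm (MeasurableSpace.generateFrom_le ?_) ?_
  · rintro _ ⟨y, -, rfl⟩
    exact (isOpen_notCrossed y).measurableSet
  obtain ⟨B, hBc, -, hB⟩ := exists_countable_basis (Quad D)
  obtain ⟨A₀, hA₀A, hA₀c, hA₀⟩ := hA.exists_countable_dense_subset
  rw [borel_eq_generateFrom_of_subbasis (eq_generateFrom_of_esb hesb hB hA₀)]
  set m := MeasurableSpace.generateFrom ((fun Q => notCrossed Q) '' A) with hm
  have hgen : ∀ y ∈ A, MeasurableSet[m] (notCrossed y) := fun y hy =>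
    MeasurableSpace.measurableSet_generateFrom (mem_image_of_mem (fun Q => notCrossed Q) hy)
  refine MeasurableSpace.generateFrom_le ?_
  rintro V (⟨U, hU, rfl⟩ | ⟨y, hy, rfl⟩)
  · beta_reduce
    rw [someCrossed_eq_biUnion_of_esb hesb hA₀ (hB.isOpen hU)]
    exact @MeasurableSet.biUnion _ _ m _ _ (hA₀c.mono inter_subset_left) fun y hy =>
      @MeasurableSet.compl _ _ m (hgen y (hA₀A hy.1))
  · exact hgen y (hA₀A hy)

end Esb

end QuadConfig

/-- **Theorem 1.4 (1)–(2) from `(esb)`** (Schramm–Smirnov, Thm. 3.9 ⇒ Thm. 1.4): if every quad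
of every open `D ⊆ ℂ` is a limit of strictly smaller quads, then `SchrammSmirnov2011_thm_1_4`
holds.  (`(esb)` for quads is the geometric input "a quad can be easily approximated by smaller
quads", proved in `QuadCrossingSpaceProofs.lean`.) [cite: SchrammSmirnov2011, §3 Thm. 3.9] -/
theorem SchrammSmirnov2011_thm_1_4_of_esb
    (hesb : ∀ D : Set ℂ, IsOpen D →
      ∀ Q : Quad D, Q ∈ closure {Q' | Quad.StrictlyDominated Q' Q}) :
    SchrammSmirnov2011_thm_1_4 := by
  intro D hD _
  have h := hesb D hD
  refine ⟨⟨QuadConfig.compactSpace, QuadConfig.metrizableSpace_of_esb h,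
    QuadConfig.t2Space_of_esb h⟩, fun A hA => ⟨fun S₁ S₂ hS => ?_, ?_⟩⟩
  · exact QuadConfig.eq_of_inter_dense_eq_of_esb h hA hS
  · exact QuadConfig.generateFrom_notCrossed_eq_borel_of_esb h hA

end QuadCrossing

end Literature.Probability.Percolation
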